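import Mathlib

/-!
# Crux `ShortCondensation` (stmt-MatrixMultiplication-15936), line `schur` — stub `stub_transportStepSchur`

Single-scale sub-scheme transport from the Schur sub-ball (registered stub; proved verbatim).

The model: points of `J(2n,n)` are `n`-subsets of `Fin (n+n)` (maximal minors of `[Iₙ | X]`); the
initial ball is `{J : #J = n ∧ #(J ∩ [n,2n)) ≤ 1}`; a listing is valid when every entry is certified by an
octahedron (three-term Plücker relation) whose other five vertices are in the ball or listed earlier.
Given `k + n' = n`, the `n`-sets containing the core columns `C = [n, n+k)` and avoiding the core rows
`[0,k)` form a copy of `J(2n',n')` under `J' ↦ C ∪ e(J')`, `e x = x + k` (`x < n'`), `e x = x + 2k`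
(`x ≥ n'`); the image of the initial ball of `J(2n',n')` is the Schur sub-ball (the leading minor `A_k`
and its bordered minors, Bareiss/Sylvester), and the image of its target is the target.  We transport a
valid target-reaching listing of `J(2n',n')` along this embedding and append it to the given listing.

The embedding `e` and the core `C` are introduced existentially (`transport_exists_emb`, and
`C = univ.filter …` inside the main proof) and handled through their characteristic properties only.
-/

set_option linter.dupNamespace false

namespace Summit.MatrixMultiplication.MatrixMultiplication.Theorems.ShortCondensation

open Finset

variable {n k n' : ℕ}

/-- The sub-scheme embedding `e : Fin (n'+n') ↪ Fin (n+n)` for `k + n' = n` exists: `e x = x + k`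
for `x < n'` and `e x = x + 2k` otherwise (its range avoids the core rows `[0,k)` and the core columns
`[n,n+k)`). [folklore] -/
theorem transport_exists_emb (hkn : k + n' = n) :
    ∃ e : Fin (n' + n') ↪ Fin (n + n),
      ∀ x, (e x).val = if x.val < n' then x.val + k else x.val + 2 * k :=
  ⟨⟨fun x => ⟨if x.val < n' then x.val + k else x.val + 2 * k, by split_ifs <;> omega⟩,
    fun x y h => by
      simp only [Fin.mk.injEq] at h
      apply Fin.ext
      split_ifs at h <;> omega⟩,
    fun _ => rfl⟩

/-- The embedding misses the core columns. [folklore] -/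
theorem transport_emb_not_mem_core (hkn : k + n' = n) {e : Fin (n' + n') ↪ Fin (n + n)}
    (he : ∀ x, (e x).val = if x.val < n' then x.val + k else x.val + 2 * k)
    {C : Finset (Fin (n + n))} (hC : ∀ x, x ∈ C ↔ n ≤ x.val ∧ x.val < n + k)
    (x : Fin (n' + n')) : e x ∉ C := by
  rw [hC, he]
  split_ifs <;> omega

/-- Every value of the embedding is `≥ k` (it misses the core rows). [folklore] -/
theorem transport_le_emb_val {e : Fin (n' + n') ↪ Fin (n + n)}
    (he : ∀ x, (e x).val = if x.val < n' then x.val + k else x.val + 2 * k) (x : Fin (n' + n')) :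
    k ≤ (e x).val := by
  rw [he]
  split_ifs <;> omega

/-- `n ≤ e x` iff `n' ≤ x`. [folklore] -/
theorem transport_le_emb_val_iff (hkn : k + n' = n) {e : Fin (n' + n') ↪ Fin (n + n)}
    (he : ∀ x, (e x).val = if x.val < n' then x.val + k else x.val + 2 * k) (x : Fin (n' + n')) :
    n ≤ (e x).val ↔ n' ≤ x.val := by
  rw [he]
  split_ifs <;> omega

/-- `e x < n + k` iff `x < n'`. [folklore] -/
theorem transport_emb_val_lt_iff (hkn : k + n' = n) {e : Fin (n' + n') ↪ Fin (n + n)}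
    (he : ∀ x, (e x).val = if x.val < n' then x.val + k else x.val + 2 * k) (x : Fin (n' + n')) :
    (e x).val < n + k ↔ x.val < n' := by
  rw [he]
  split_ifs <;> omega

/-- `e x ∈ C ∪ e(J) ↔ x ∈ J` (membership in a lift). [folklore] -/
theorem transport_emb_mem_lift (hkn : k + n' = n) {e : Fin (n' + n') ↪ Fin (n + n)}
    (he : ∀ x, (e x).val = if x.val < n' then x.val + k else x.val + 2 * k)
    {C : Finset (Fin (n + n))} (hC : ∀ x, x ∈ C ↔ n ≤ x.val ∧ x.val < n + k)
    {J : Finset (Fin (n' + n'))} {x : Fin (n' + n')} : e x ∈ C ∪ J.map e ↔ x ∈ J := by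
  rw [mem_union, mem_map']
  have := transport_emb_not_mem_core hkn he hC x
  tauto

/-- Lift of an insertion. [folklore] -/
theorem transport_lift_insert (e : Fin (n' + n') ↪ Fin (n + n)) (C : Finset (Fin (n + n)))
    (J : Finset (Fin (n' + n'))) (u : Fin (n' + n')) :
    C ∪ (insert u J).map e = insert (e u) (C ∪ J.map e) := by
  rw [map_insert, union_insert]

/-- Lift of an erasure. [folklore] -/
theorem transport_lift_erase (hkn : k + n' = n) {e : Fin (n' + n') ↪ Fin (n + n)}
    (he : ∀ x, (e x).val = if x.val < n' then x.val + k else x.val + 2 * k)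
    {C : Finset (Fin (n + n))} (hC : ∀ x, x ∈ C ↔ n ≤ x.val ∧ x.val < n + k)
    (J : Finset (Fin (n' + n'))) (p : Fin (n' + n')) :
    C ∪ (J.erase p).map e = (C ∪ J.map e).erase (e p) := by
  rw [map_erase, erase_union_distrib, erase_eq_of_notMem (transport_emb_not_mem_core hkn he hC p)]

/-- Cardinality of the core columns: `k` (using `k ≤ n`). [folklore] -/
theorem transport_card_core (hkn : k + n' = n) {C : Finset (Fin (n + n))}
    (hC : ∀ x, x ∈ C ↔ n ≤ x.val ∧ x.val < n + k) : C.card = k := by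
  have h : C.map Fin.valEmbedding = Finset.Ico n (n + k) := by
    ext v
    simp only [mem_map, hC, Fin.valEmbedding_apply, mem_Ico]
    constructor
    · rintro ⟨x, hx, rfl⟩
      exact hx
    · rintro hv
      exact ⟨⟨v, by omega⟩, hv, rfl⟩
  rw [← card_map Fin.valEmbedding, h, Nat.card_Ico]
  omega

/-- Cardinality of a lift: `#(C ∪ e(J)) = k + #J`. [folklore] -/
theorem transport_card_lift (hkn : k + n' = n) {e : Fin (n' + n') ↪ Fin (n + n)}
    (he : ∀ x, (e x).val = if x.val < n' then x.val + k else x.val + 2 * k)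
    {C : Finset (Fin (n + n))} (hC : ∀ x, x ∈ C ↔ n ≤ x.val ∧ x.val < n + k)
    (J : Finset (Fin (n' + n'))) : (C ∪ J.map e).card = k + J.card := by
  rw [card_union_of_disjoint, transport_card_core hkn hC, card_map]
  exact disjoint_right.2 fun y hy hc => by
    obtain ⟨x, -, rfl⟩ := mem_map.1 hy
    exact transport_emb_not_mem_core hkn he hC x hc

/-- A lifted point of the initial ball of `J(2n',n')` satisfies the four hypotheses of the Schur
sub-ball clause (cardinality `n`, within distance `1` of `H_k = [k, n+k)`, contains the core columns,
avoids the core rows). [folklore] -/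
theorem transport_lift_schur (hkn : k + n' = n) {e : Fin (n' + n') ↪ Fin (n + n)}
    (he : ∀ x, (e x).val = if x.val < n' then x.val + k else x.val + 2 * k)
    {C : Finset (Fin (n + n))} (hC : ∀ x, x ∈ C ↔ n ≤ x.val ∧ x.val < n + k)
    {M : Finset (Fin (n' + n'))} (hc : M.card = n')
    (hb : (M.filter fun x : Fin (n' + n') => n' ≤ x.val).card ≤ 1) :
    (C ∪ M.map e).card = n ∧
    ((C ∪ M.map e) \
        (Finset.univ.filter fun x : Fin (n + n) => k ≤ x.val ∧ x.val < n + k)).card ≤ 1 ∧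
    (∀ x : Fin (n + n), n ≤ x.val → x.val < n + k → x ∈ C ∪ M.map e) ∧
    (∀ x ∈ C ∪ M.map e, k ≤ x.val) := by
  refine ⟨by rw [transport_card_lift hkn he hC, hc, hkn], ?_, fun x h1 h2 => ?_, fun x hx => ?_⟩
  · calc ((C ∪ M.map e) \
          (Finset.univ.filter fun x : Fin (n + n) => k ≤ x.val ∧ x.val < n + k)).card
        ≤ ((M.filter fun x : Fin (n' + n') => n' ≤ x.val).map e).card := by
          refine card_le_card fun y hy => ?_
          rw [mem_sdiff, mem_union] at hy
          obtain ⟨hy, hH⟩ := hy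
          simp only [mem_filter, mem_univ, true_and, not_and, not_lt] at hH
          rcases hy with hy | hy
          · rw [hC] at hy
            omega
          · obtain ⟨x, hx, rfl⟩ := mem_map.1 hy
            refine mem_map.2 ⟨x, mem_filter.2 ⟨hx, ?_⟩, rfl⟩
            have h1 := transport_le_emb_val he x
            have h2 := transport_emb_val_lt_iff hkn he x
            by_contra hlt
            have h3 := h2.2 (lt_of_not_ge hlt)
            have h4 := hH h1
            omega
      _ = (M.filter fun x : Fin (n' + n') => n' ≤ x.val).card := card_map _
      _ ≤ 1 := hb
  · exact mem_union_left _ ((hC x).2 ⟨h1, h2⟩)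
  · rcases mem_union.1 hx with hx | hx
    · rw [hC] at hx
      omega
    · obtain ⟨y, -, rfl⟩ := mem_map.1 hx
      exact transport_le_emb_val he y

/-- The lifted target of `J(2n',n')` is the target of `J(2n,n)`. [folklore] -/
theorem transport_lift_target (hkn : k + n' = n) {e : Fin (n' + n') ↪ Fin (n + n)}
    (he : ∀ x, (e x).val = if x.val < n' then x.val + k else x.val + 2 * k)
    {C : Finset (Fin (n + n))} (hC : ∀ x, x ∈ C ↔ n ≤ x.val ∧ x.val < n + k) :
    C ∪ (Finset.univ.filter fun x : Fin (n' + n') => n' ≤ x.val).map e =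
      Finset.univ.filter fun x : Fin (n + n) => n ≤ x.val := by
  ext y
  rw [mem_union, hC, mem_map]
  simp only [mem_filter, mem_univ, true_and]
  constructor
  · rintro (h | ⟨x, hx, rfl⟩)
    · exact h.1
    · exact (transport_le_emb_val_iff hkn he x).2 hx
  · intro hy
    by_cases h : y.val < n + k
    · exact Or.inl ⟨hy, h⟩
    · have hy2 := y.isLt
      refine Or.inr ⟨⟨y.val - 2 * k, by omega⟩, ?_, ?_⟩
      · show n' ≤ y.val - 2 * k
        omega
      · apply Fin.ext
        rw [he]
        show (if y.val - 2 * k < n' then y.val - 2 * k + k else y.val - 2 * k + 2 * k) = y.val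
        rw [if_neg (by omega)]
        omega

/-- **Single-scale sub-scheme transport from the Schur sub-ball** (the combinatorial content of one
scale of the recursion `D(n) ≤ T(n) + D(n - k)`): if `k + n' = n`, `f₁` is a valid derivation in
`J(2n,n)` after which every `n`-set containing the core columns `[n,n+k)`, avoiding the core rows `[0,k)`
and within distance `1` of `H_k = {k ≤ x < n + k}` is known, and `f₂` is a valid derivation in
`J(2n',n')` listing its target `{n' ≤ x}`, then some valid derivation in `J(2n,n)` of length `≤ l₁ + l₂`
lists the target `{n ≤ x}` — namely `f₁` followed by `i ↦ [n, n+k) ∪ e (f₂ i)` with `e x = x + k` for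
`x < n'`, `e x = x + 2k` otherwise: lifted octahedra are octahedra, the lifted initial ball of
`J(2n',n')` is exactly the Schur sub-ball (the leading minor and its bordered minors, Sylvester's
identity as in Bareiss1968; cf. BurgisserClausenShokrollahi1997 §16), and the lifted target is the
target. [folklore] -/
theorem stub_transportStepSchur :
    ∀ (n k n' : ℕ), k + n' = n →
    ∀ (l₁ : ℕ) (f₁ : Fin l₁ → Finset (Fin (n + n))) (l₂ : ℕ) (f₂ : Fin l₂ → Finset (Fin (n' + n'))),
      (∀ i : Fin l₁, ∃ p ∈ f₁ i, ∃ q ∈ f₁ i, p ≠ q ∧ ∃ u ∉ f₁ i, ∃ v ∉ f₁ i, u ≠ v ∧ ∀ J ∈ [insert u ((f₁ i).erase p), insert v ((f₁ i).erase p), insert u ((f₁ i).erase q), insert v ((f₁ i).erase q), insert u (insert v (((f₁ i).erase p).erase q))], (J.card = n ∧ (J.filter fun x : Fin (n + n) => n ≤ x.val).card ≤ 1) ∨ ∃ j : Fin l₁, j < i ∧ f₁ j = J) →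
      (∀ J : Finset (Fin (n + n)), J.card = n → (J \ (Finset.univ.filter fun x : Fin (n + n) => k ≤ x.val ∧ x.val < n + k)).card ≤ 1 → (∀ x : Fin (n + n), n ≤ x.val → x.val < n + k → x ∈ J) → (∀ x ∈ J, k ≤ x.val) → (J.card = n ∧ (J.filter fun x : Fin (n + n) => n ≤ x.val).card ≤ 1) ∨ ∃ i : Fin l₁, f₁ i = J) →
      (∀ i : Fin l₂, ∃ p ∈ f₂ i, ∃ q ∈ f₂ i, p ≠ q ∧ ∃ u ∉ f₂ i, ∃ v ∉ f₂ i, u ≠ v ∧ ∀ J ∈ [insert u ((f₂ i).erase p), insert v ((f₂ i).erase p), insert u ((f₂ i).erase q), insert v ((f₂ i).erase q), insert u (insert v (((f₂ i).erase p).erase q))], (J.card = n' ∧ (J.filter fun x : Fin (n' + n') => n' ≤ x.val).card ≤ 1) ∨ ∃ j : Fin l₂, j < i ∧ f₂ j = J) →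
      (∃ i : Fin l₂, f₂ i = Finset.univ.filter fun x : Fin (n' + n') => n' ≤ x.val) →
      ∃ (l : ℕ) (f : Fin l → Finset (Fin (n + n))), l ≤ l₁ + l₂ ∧
        (∀ i : Fin l, ∃ p ∈ f i, ∃ q ∈ f i, p ≠ q ∧ ∃ u ∉ f i, ∃ v ∉ f i, u ≠ v ∧ ∀ J ∈ [insert u ((f i).erase p), insert v ((f i).erase p), insert u ((f i).erase q), insert v ((f i).erase q), insert u (insert v (((f i).erase p).erase q))], (J.card = n ∧ (J.filter fun x : Fin (n + n) => n ≤ x.val).card ≤ 1) ∨ ∃ j : Fin l, j < i ∧ f j = J) ∧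
        ∃ i : Fin l, f i = Finset.univ.filter fun x : Fin (n + n) => n ≤ x.val := by
  intro n k n' hkn l₁ f₁ l₂ f₂ hv₁ hK hv₂ htarget
  obtain ⟨i₀, hi₀⟩ := htarget
  -- the embedding `e` and the core columns `C`, through their characteristic properties only
  obtain ⟨e, he⟩ := transport_exists_emb hkn
  obtain ⟨C, hC⟩ : ∃ C : Finset (Fin (n + n)), ∀ x, x ∈ C ↔ n ≤ x.val ∧ x.val < n + k :=
    ⟨Finset.univ.filter fun x : Fin (n + n) => n ≤ x.val ∧ x.val < n + k, fun x => by simp⟩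
  -- Transfer of knowledge along the lift: a mate known in `J(2n',n')` before step `i₂` lifts to a
  -- mate known in `J(2n,n)` before step `l₁ + i₂` of the combined listing.
  have transfer : ∀ (i₂ : Fin l₂) (M : Finset (Fin (n' + n'))),
      ((M.card = n' ∧ (M.filter fun x : Fin (n' + n') => n' ≤ x.val).card ≤ 1) ∨
        ∃ j : Fin l₂, j < i₂ ∧ f₂ j = M) →
      ((C ∪ M.map e).card = n ∧
          ((C ∪ M.map e).filter fun x : Fin (n + n) => n ≤ x.val).card ≤ 1) ∨
        ∃ j : Fin (l₁ + l₂), j < Fin.natAdd l₁ i₂ ∧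
          Fin.append f₁ (fun i => C ∪ (f₂ i).map e) j = C ∪ M.map e := by
    rintro i₂ M (⟨hc, hb⟩ | ⟨j, hj, rfl⟩)
    · obtain ⟨h1, h2, h3, h4⟩ := transport_lift_schur hkn he hC hc hb
      rcases hK _ h1 h2 h3 h4 with hball | ⟨i₁, hi₁⟩
      · exact Or.inl hball
      · refine Or.inr ⟨Fin.castAdd l₂ i₁, ?_, by rw [Fin.append_left]; exact hi₁⟩
        rw [Fin.lt_def, Fin.val_castAdd, Fin.val_natAdd]
        omega
    · refine Or.inr ⟨Fin.natAdd l₁ j, ?_, by rw [Fin.append_right]⟩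
      rw [Fin.lt_def, Fin.val_natAdd, Fin.val_natAdd]
      exact Nat.add_lt_add_left hj l₁
  refine ⟨l₁ + l₂, Fin.append f₁ (fun i => C ∪ (f₂ i).map e), le_rfl, fun i => ?_,
    Fin.natAdd l₁ i₀, by rw [Fin.append_right, hi₀, transport_lift_target hkn he hC]⟩
  induction i using Fin.addCases with
  | left i₁ =>
    -- first block: the given listing, earlier indices stay earlier
    rw [Fin.append_left]
    obtain ⟨p, hp, q, hq, hpq, u, hu, v, hv, huv, hM⟩ := hv₁ i₁
    refine ⟨p, hp, q, hq, hpq, u, hu, v, hv, huv, fun J hJ => ?_⟩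
    rcases hM J hJ with hb | ⟨j, hj, hfj⟩
    · exact Or.inl hb
    · refine Or.inr ⟨Fin.castAdd l₂ j, ?_, by rw [Fin.append_left]; exact hfj⟩
      rw [Fin.lt_def, Fin.val_castAdd, Fin.val_castAdd]
      exact hj
  | right i₂ =>
    -- second block: the lifted listing, lifted octahedra are octahedra
    rw [Fin.append_right]
    obtain ⟨p, hp, q, hq, hpq, u, hu, v, hv, huv, hM⟩ := hv₂ i₂
    refine ⟨e p, (transport_emb_mem_lift hkn he hC).2 hp, e q,
      (transport_emb_mem_lift hkn he hC).2 hq, fun h => hpq (e.injective h),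
      e u, fun h => hu ((transport_emb_mem_lift hkn he hC).1 h),
      e v, fun h => hv ((transport_emb_mem_lift hkn he hC).1 h),
      fun h => huv (e.injective h), ?_⟩
    simp only [← transport_lift_erase hkn he hC, ← transport_lift_insert e C]
    intro J hJ
    simp only [List.mem_cons, List.not_mem_nil, or_false] at hJ
    rcases hJ with rfl | rfl | rfl | rfl | rfl <;> exact transfer i₂ _ (hM _ (by simp))

end Summit.MatrixMultiplication.MatrixMultiplication.Theorems.ShortCondensation
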